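import Literature.Combinatorics.LorentzianPolynomials.NuijHomotopy
import Literature.Combinatorics.LorentzianPolynomials.NonnegativeLinearSubstitution
import Literature.Combinatorics.LorentzianPolynomials.RayleighOptimalHigherDegree
import Mathlib.Analysis.SpecificLimits.Basic
import Mathlib.Topology.Algebra.Polynomial
import HarnessLib

/-!
# Brändén–Huh Theorem 2.13: `L^d_n` lies in the closure of `L̊^d_n` (and Theorem 2.25, first sentence)

Layer `Literature/Combinatorics/LorentzianPolynomials`, namespace `Literature.Combinatorics.LorentzianPolynomials`;
lane `lit-hodgefound` (Track 2 foundations library), seat p16, generation 29 (row g29-#10). With Lemma 2.12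
(`NuijHomotopy.nuijOperator_mem_strictlyLorentzian`) and Theorem 2.10 (`NonnegativeLinearSubstitution.
linearSubst_mem_lorentzian`) in the tree, the printed proof of Theorem 2.13 goes through: for `0 ≠ f ∈ L^d_n` the
homotopy `θ ↦ T_n(θ, S(θ, f))`, `S(θ, f) = f((1-θ)w + θ(w_1 + ⋯ + w_n)𝟙)` (the normalisation `|f|_1^{-1}` of the source
is immaterial for the conclusion and omitted), runs inside `L̊^d_n` for `θ > 0` and tends to `f` coefficientwise as
`θ → 0⁺`. Together with `LorentzianClosed.mem_lorentzian_of_tendsto_coeff_of_strictlyLorentzian` (row g29-#4) this is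
the first sentence of Theorem 2.25: **`L^d_n` (Definition 2.6) is exactly the set of coefficientwise limits of
strictly Lorentzian polynomials (Definition 2.1)** — for `n ≥ 1`.

## Source (verbatim) — P. Brändén, J. Huh, *Lorentzian polynomials* [BrandenHuh2019] (held `paper:arxiv-1902.03719`)

§2.3 (p. 16): "We use Lemma 2.12 to prove the main result of this subsection. **Theorem 2.13.** The closure of `L̊^d_n`
in `H^d_n` contains `L^d_n`. *Proof.* Let `f` be a polynomial in `L^d_n` that is not identically zero, and let `θ` be
a real parameter satisfying `0 ≤ θ ≤ 1`. By Theorem 2.10, we have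
`S(θ, f) := |f|_1^{-1} f((1-θ)w_1 + θ(w_1 + ⋯ + w_n), …, (1-θ)w_n + θ(w_1 + ⋯ + w_n)) ∈ L^d_n`, where `|f|_1` is the
sum of all coefficients of `f`. Since `S(θ, f)` belongs to `P^d_n` when `0 < θ ≤ 1`, Lemma 2.12 shows that we have a
homotopy `T_n(θ, S(θ, f)) ∈ L̊^d_n`, `0 < θ ≤ 1`, that deforms `f` to the polynomial `T_n(1, (w_1 + ⋯ + w_n)^d)`. It
follows that the closure of `L̊^d_n` in `H^d_n` contains `L^d_n`. We show in Theorem 2.25 that the closure of `L̊^d_n`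
in `H^d_n` is, in fact, equal to `L^d_n`." §2.4 (p. 24): "**Theorem 2.25.** The closure of `L̊^d_n` in `H^d_n` is
`L^d_n`."

## What is here

* §1 "`S(θ, f)` belongs to `P^d_n` when `0 < θ`": a nonzero form with nonnegative coefficients composed with a
  linear substitution all of whose matrix entries are positive has all top-degree coefficients positive
  (`coeff_linearSubst_pos`; products of linear forms with positive coefficients).
* §2 `L̊^d_n` is invariant under positive scalars (`smul_mem_strictlyLorentzian`).
* §3 the homotopy with a generic parameter: `(1 + c w_i ∂_j)`, `T`, `S` over any commutative coefficient ring,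
  compatibility with `MvPolynomial.map` (so that every coefficient of `T_n(θ, S(θ, f))` is a real polynomial in `θ`).
* §4 **Theorem 2.13** (`exists_seq_strictlyLorentzian_tendsto_coeff`): every `f ∈ L^d_n` (`n ≥ 1`) is a coefficientwise
  limit of a sequence in `L̊^d_n`; **Theorem 2.25, first sentence** (`mem_lorentzian_iff_exists_seq_strictlyLorentzian`).

Four auxiliary definitions with bodies (`oneAddXPderivC`, `nuijOperatorC`, `mixSubstC`, `nuijHomotopy`), theorems
otherwise; no `sorry`, no named fact (net debt 0). For `n = 0` the statement fails in this encoding (`0 ∈ L²_0` while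
`L̊²_0 = ∅`), whence `[Nonempty σ]`.

## References

* [BrandenHuh2019] P. Brändén, J. Huh, *Lorentzian polynomials*, Ann. of Math. (2) 192 (2020) 821–891, arXiv:1902.03719 —
  §2.3 Thm. 2.13 (p. 16), Lemma 2.12; §2.2 Thm. 2.10; §2.4 Thm. 2.25 (p. 24).
-/

noncomputable section

open MvPolynomial Finsupp Finset Filter Topology
open Literature.LinearAlgebra.QuadraticForm

namespace Literature.Combinatorics.LorentzianPolynomials

variable {σ : Type*} [Fintype σ] [DecidableEq σ]

/-! ## §1 `P^d_n` under positive linear substitutions -/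

section Positive

variable {τ : Type*} [Fintype τ] [DecidableEq τ]

omit [Fintype σ] [DecidableEq σ] [DecidableEq τ] in
/-- A form with positive top-degree coefficients times a linear form with positive coefficients has positive
top-degree coefficients. [cite: BrandenHuh2019, §2.3 proof of Thm. 2.13 ("`S(θ, f)` belongs to `P^d_n` when
`0 < θ ≤ 1`")] -/
theorem coeff_mul_linear_pos {e : ℕ} {g : MvPolynomial τ ℝ} (hg : g.IsHomogeneous e)
    (hgpos : ∀ β : τ →₀ ℕ, β.degree = e → 0 < coeff β g) {a : τ → ℝ} (ha : ∀ k, 0 < a k) (β : τ →₀ ℕ)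
    (hβ : β.degree = e + 1) : 0 < coeff β (g * ∑ k, a k • X k) := by
  classical
  have hterm : ∀ k, coeff β (g * a k • X k) =
      a k * (if k ∈ β.support then coeff (β - Finsupp.single k 1) g else 0) := fun k ↦ by
    rw [mul_smul_comm, coeff_smul, smul_eq_mul, coeff_mul_X']
  rw [Finset.mul_sum, coeff_sum]
  simp only [hterm]
  have hβ0 : β ≠ 0 := by
    intro h; rw [h, map_zero] at hβ; omega
  obtain ⟨k, hk⟩ := Finsupp.ne_iff.1 hβ0
  have hk' : β k ≠ 0 := by simpa using hk
  refine Finset.sum_pos' (fun k' _ ↦ mul_nonneg (ha k').le ?_) ⟨k, Finset.mem_univ k, ?_⟩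
  · split_ifs
    · exact coeff_nonneg_of_forall_coeff_pos hg hgpos _
    · exact le_rfl
  · rw [if_pos (Finsupp.mem_support_iff.2 hk')]
    refine mul_pos (ha k) (hgpos _ ?_)
    have h := degree_sub_single_add_one hk'
    omega

omit [DecidableEq τ] in
/-- A linear form `Σ_k a_k v_k` is homogeneous of degree `1`. [cite: BrandenHuh2019, §2.2 Thm. 2.10 (`f(Av)`)] -/
theorem isHomogeneous_sum_smul_X (a : τ → ℝ) : (∑ k, a k • X k : MvPolynomial τ ℝ).IsHomogeneous 1 := by
  refine IsHomogeneous.sum _ _ _ fun k _ ↦ ?_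
  rw [smul_eq_C_mul]
  simpa using (isHomogeneous_C τ (a k)).mul (isHomogeneous_X ℝ k)

omit [Fintype σ] [DecidableEq σ] [DecidableEq τ] in
/-- Powers of a linear form with positive coefficients keep top-degree coefficients positive.
[cite: BrandenHuh2019, §2.3 proof of Thm. 2.13 ("`S(θ, f)` belongs to `P^d_n`")] -/
theorem coeff_mul_linear_pow_pos {e : ℕ} {g : MvPolynomial τ ℝ} (hg : g.IsHomogeneous e)
    (hgpos : ∀ β : τ →₀ ℕ, β.degree = e → 0 < coeff β g) {a : τ → ℝ} (ha : ∀ k, 0 < a k) :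
    ∀ (b : ℕ), (g * (∑ k, a k • X k) ^ b).IsHomogeneous (e + b) ∧
      ∀ β : τ →₀ ℕ, β.degree = e + b → 0 < coeff β (g * (∑ k, a k • X k) ^ b)
  | 0 => by simpa using ⟨hg, hgpos⟩
  | b + 1 => by
    obtain ⟨hhom, hpos⟩ := coeff_mul_linear_pow_pos hg hgpos ha b
    refine ⟨?_, fun β hβ ↦ ?_⟩
    · rw [pow_succ, ← mul_assoc]
      exact hhom.mul (isHomogeneous_sum_smul_X a)
    · rw [pow_succ, ← mul_assoc]
      exact coeff_mul_linear_pos hhom hpos ha β (by rw [hβ]; ring)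

omit [Fintype σ] [DecidableEq σ] [DecidableEq τ] in
/-- A product `∏_i ℓ_i^{γ_i}` of powers of linear forms with positive coefficients is homogeneous of degree `|γ|` with all
top-degree coefficients positive. [cite: BrandenHuh2019, §2.3 proof of Thm. 2.13 ("`S(θ, f)` belongs to `P^d_n`")] -/
theorem coeff_prod_linear_pow_pos {A : σ → τ → ℝ} (hA : ∀ i k, 0 < A i k) (γ : σ →₀ ℕ) :
    (γ.prod fun i n ↦ (∑ k, A i k • X k : MvPolynomial τ ℝ) ^ n).IsHomogeneous γ.degree ∧
      ∀ β : τ →₀ ℕ, β.degree = γ.degree →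
        0 < coeff β (γ.prod fun i n ↦ (∑ k, A i k • X k : MvPolynomial τ ℝ) ^ n) := by
  classical
  induction γ using Finsupp.induction with
  | zero =>
    refine ⟨by simpa using isHomogeneous_one τ ℝ, fun β hβ ↦ ?_⟩
    rw [map_zero, Finsupp.degree_eq_zero_iff] at hβ
    rw [hβ, Finsupp.prod_zero_index, coeff_one, if_pos rfl]
    exact one_pos
  | single_add a b γ' ha hb ih =>
    obtain ⟨hhom, hpos⟩ := ih
    rw [Finsupp.prod_add_index' (h := fun i n ↦ (∑ k, A i k • X k : MvPolynomial τ ℝ) ^ n) (fun _ ↦ pow_zero _)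
        (fun _ _ _ ↦ pow_add _ _ _),
      Finsupp.prod_single_index (h := fun i n ↦ (∑ k, A i k • X k : MvPolynomial τ ℝ) ^ n) (pow_zero _), mul_comm,
      map_add, degree_single, add_comm b]
    exact coeff_mul_linear_pow_pos hhom hpos (hA a) b

omit [Fintype σ] [DecidableEq σ] [DecidableEq τ] in
/-- **"`S(θ, f)` belongs to `P^d_n` when `0 < θ`"**: if `f ≠ 0` is homogeneous of degree `d` with nonnegative
coefficients and every entry of `A` is positive, then every degree-`d` coefficient of `f(Av)` (`linearSubst A f`) is
positive. [cite: BrandenHuh2019, §2.3 proof of Thm. 2.13 (p. 16)] -/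
theorem coeff_linearSubst_pos {A : σ → τ → ℝ} (hA : ∀ i k, 0 < A i k) {d : ℕ} {f : MvPolynomial σ ℝ}
    (hf : f.IsHomogeneous d) (hnn : ∀ γ, 0 ≤ coeff γ f) (hf0 : f ≠ 0) (β : τ →₀ ℕ) (hβ : β.degree = d) :
    0 < coeff β (linearSubst A f) := by
  classical
  have hS : linearSubst A f =
      ∑ γ ∈ f.support, C (coeff γ f) * γ.prod fun i n ↦ (∑ k, A i k • X k : MvPolynomial τ ℝ) ^ n := by
    conv_lhs => rw [linearSubst, f.as_sum]
    rw [map_sum]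
    exact Finset.sum_congr rfl fun γ _ ↦ by rw [bind₁_monomial]; rfl
  rw [hS, coeff_sum]
  simp only [coeff_C_mul]
  obtain ⟨γ₀, hγ₀⟩ := ne_zero_iff.1 hf0
  have hdeg : ∀ γ ∈ f.support, γ.degree = d := fun γ hγ ↦ by
    by_contra hne
    exact (MvPolynomial.mem_support_iff.1 hγ) (hf.coeff_eq_zero hne)
  refine Finset.sum_pos' (fun γ _ ↦ mul_nonneg (hnn γ) ?_) ⟨γ₀, MvPolynomial.mem_support_iff.2 hγ₀, ?_⟩
  · obtain ⟨hhom, hpos⟩ := coeff_prod_linear_pow_pos hA γ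
    exact coeff_nonneg_of_forall_coeff_pos hhom hpos β
  · obtain ⟨-, hpos⟩ := coeff_prod_linear_pow_pos hA γ₀
    exact mul_pos (lt_of_le_of_ne (hnn γ₀) (Ne.symm hγ₀))
      (hpos β (by rw [hβ, hdeg γ₀ (MvPolynomial.mem_support_iff.2 hγ₀)]))

end Positive

/-! ## §2 `L̊^d_n` is a cone -/

section Cone

/-- **Positive scalars preserve `L̊^d_n`**: `P^d_n` is a cone, `det(c𝓗) = c^n det 𝓗 ≠ 0`, and `c𝓗` has the same positive
index. [cite: BrandenHuh2019, §2.3 proof of Thm. 2.13 (the normalisation `|f|_1^{-1}`); §2.1 Def. 2.1] -/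
theorem smul_mem_strictlyLorentzian : ∀ {d : ℕ} {f : MvPolynomial σ ℝ}, f ∈ strictlyLorentzian σ d →
    ∀ {c : ℝ}, 0 < c → c • f ∈ strictlyLorentzian σ d := by
  have hhom : ∀ {d : ℕ} {f : MvPolynomial σ ℝ} (c : ℝ), f.IsHomogeneous d → (c • f).IsHomogeneous d :=
    fun c hf ↦ (homogeneousSubmodule σ ℝ _).smul_mem c hf
  have hpos : ∀ {d : ℕ} {f : MvPolynomial σ ℝ} {c : ℝ}, 0 < c → (∀ α : σ →₀ ℕ, α.degree = d → 0 < coeff α f) →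
      ∀ α : σ →₀ ℕ, α.degree = d → 0 < coeff α (c • f) :=
    fun hc hf α hα ↦ by rw [coeff_smul, smul_eq_mul]; exact mul_pos hc (hf α hα)
  intro d
  induction d using Nat.strong_induction_on with
  | _ d ih =>
    intro f hf c hc
    match d, hf, ih with
    | 0, hf, _ => exact ⟨hhom c hf.1, hpos hc hf.2⟩
    | 1, hf, _ => exact ⟨hhom c hf.1, hpos hc hf.2⟩
    | 2, hf, _ =>
      obtain ⟨h1, h2, h3, h4⟩ := hf
      refine ⟨hhom c h1, hpos hc h2, ?_, ?_⟩
      · rw [hessian_smul, Matrix.det_smul]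
        exact mul_ne_zero (pow_ne_zero _ hc.ne') h3
      · rw [hessian_smul, map_smul, Literature.LinearAlgebra.QuadraticForm.sigPos_smul_of_pos _ hc]
        exact h4
    | d + 3, hf, ih =>
      obtain ⟨h1, h2, h3⟩ := hf
      refine ⟨hhom c h1, hpos hc h2, fun i ↦ ?_⟩
      rw [(pderiv i).map_smul]
      exact ih (d + 2) (by omega) (h3 i) hc

end Cone

/-! ## §3 The homotopy with a generic parameter -/

section Generic

variable {R S : Type*} [CommRing R] [CommRing S]

omit [Fintype σ] [DecidableEq σ] in
/-- `(1 + c w_i ∂_j) F` over any commutative coefficient ring (`c ∈ R`). [cite: BrandenHuh2019, §2.3 (the operators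
`1 + θ w_i ∂_n`, `θ` "a real parameter")] -/
def oneAddXPderivC (c : R) (i j : σ) (F : MvPolynomial σ R) : MvPolynomial σ R := F + C c * (X i * pderiv j F)

omit [Fintype σ] [DecidableEq σ] in
/-- Over `ℝ`, `oneAddXPderivC θ = oneAddXPderiv θ`. [cite: BrandenHuh2019, §2.3 (the operators `1 + θ w_i ∂_n`)] -/
theorem oneAddXPderivC_eq (θ : ℝ) (i j : σ) (f : MvPolynomial σ ℝ) :
    oneAddXPderivC θ i j f = oneAddXPderiv θ i j f := by
  rw [oneAddXPderivC, oneAddXPderiv_def, smul_eq_C_mul]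

omit [Fintype σ] [DecidableEq σ] in
/-- `(1 + c w_i ∂_j)` commutes with a change of coefficients `φ` (`c ↦ φ c`). [cite: BrandenHuh2019, §2.3 proof of
Thm. 2.13 (the homotopy in the parameter `θ`)] -/
theorem map_oneAddXPderivC (φ : R →+* S) (c : R) (i j : σ) (F : MvPolynomial σ R) :
    map φ (oneAddXPderivC c i j F) = oneAddXPderivC (φ c) i j (map φ F) := by
  rw [oneAddXPderivC, oneAddXPderivC, map_add, map_mul, map_mul, map_C, map_X, pderiv_map]

omit [Fintype σ] [DecidableEq σ] in
/-- The same for the powers `(1 + c w_i ∂_j)^k`. [cite: BrandenHuh2019, §2.3 proof of Thm. 2.13] -/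
theorem map_iterate_oneAddXPderivC (φ : R →+* S) (c : R) (i j : σ) :
    ∀ (k : ℕ) (F : MvPolynomial σ R),
      map φ ((oneAddXPderivC c i j)^[k] F) = (oneAddXPderivC (φ c) i j)^[k] (map φ F)
  | 0, F => by simp only [Function.iterate_zero, id_eq]
  | k + 1, F => by
    rw [Function.iterate_succ_apply', Function.iterate_succ_apply', map_oneAddXPderivC,
      map_iterate_oneAddXPderivC φ c i j k F]

/-- `T_n(c, -) = ∏_{i ≠ j} (1 + c w_i ∂_j)^d` over any commutative coefficient ring. [cite: BrandenHuh2019, §2.3 (the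
operator `T_n(θ, -)`)] -/
def nuijOperatorC (c : R) (j : σ) (d : ℕ) (F : MvPolynomial σ R) : MvPolynomial σ R :=
  (Finset.univ.erase j).toList.foldr (fun i G ↦ (oneAddXPderivC c i j)^[d] G) F

omit [Fintype σ] [DecidableEq σ] in
/-- A composite of generic blocks commutes with a change of coefficients. [cite: BrandenHuh2019, §2.3 proof of
Thm. 2.13] -/
theorem map_foldr_iterate_oneAddXPderivC (φ : R →+* S) (c : R) (j : σ) (d : ℕ) :
    ∀ (l : List σ) (F : MvPolynomial σ R), map φ (l.foldr (fun i G ↦ (oneAddXPderivC c i j)^[d] G) F) =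
      l.foldr (fun i G ↦ (oneAddXPderivC (φ c) i j)^[d] G) (map φ F)
  | [], F => rfl
  | i :: l, F => by
    rw [List.foldr_cons, List.foldr_cons, map_iterate_oneAddXPderivC, map_foldr_iterate_oneAddXPderivC φ c j d l F]

/-- `T` commutes with a change of coefficients. [cite: BrandenHuh2019, §2.3 proof of Thm. 2.13] -/
theorem map_nuijOperatorC (φ : R →+* S) (c : R) (j : σ) (d : ℕ) (F : MvPolynomial σ R) :
    map φ (nuijOperatorC c j d F) = nuijOperatorC (φ c) j d (map φ F) :=
  map_foldr_iterate_oneAddXPderivC φ c j d _ F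

/-- Over `ℝ`, `nuijOperatorC θ = nuijOperator θ`. [cite: BrandenHuh2019, §2.3 (the operator `T_n(θ, -)`)] -/
theorem nuijOperatorC_eq (θ : ℝ) (j : σ) (d : ℕ) (f : MvPolynomial σ ℝ) :
    nuijOperatorC θ j d f = nuijOperator θ j d f := by
  rw [nuijOperatorC, nuijOperator]
  congr 1
  funext i G
  rw [show (oneAddXPderivC θ i j : MvPolynomial σ ℝ → MvPolynomial σ ℝ) = oneAddXPderiv θ i j from
    funext (oneAddXPderivC_eq θ i j)]

/-- **`S(c, F) = F((1-c)w + c(w_1 + ⋯ + w_n)𝟙)`**, i.e. `w_i ↦ Σ_k a_{ik} w_k` with `a_{ii} = 1`, `a_{ik} = c` (`i ≠ k`),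
over any commutative coefficient ring. [cite: BrandenHuh2019, §2.3 proof of Thm. 2.13 (the substitution `S(θ, f)`,
without the normalisation `|f|_1^{-1}`)] -/
def mixSubstC (c : R) (F : MvPolynomial σ R) : MvPolynomial σ R :=
  bind₁ (fun i ↦ ∑ k, C (if i = k then 1 else c) * X k) F

/-- `S` commutes with a change of coefficients. [cite: BrandenHuh2019, §2.3 proof of Thm. 2.13] -/
theorem map_mixSubstC (φ : R →+* S) (c : R) (F : MvPolynomial σ R) :
    map φ (mixSubstC c F) = mixSubstC (φ c) (map φ F) := by
  have h : (fun i : σ ↦ map φ (∑ k, C (if i = k then (1 : R) else c) * X k)) =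
      fun i ↦ ∑ k, C (if i = k then (1 : S) else φ c) * X k := by
    funext i
    rw [map_sum]
    refine Finset.sum_congr rfl fun k _ ↦ ?_
    rw [map_mul, map_C, map_X]
    by_cases hik : i = k
    · rw [if_pos hik, if_pos hik, map_one]
    · rw [if_neg hik, if_neg hik]
  rw [mixSubstC, mixSubstC, map_bind₁, h]

/-- Over `ℝ`, `S(θ, f)` is the nonnegative linear substitution `linearSubst` of Theorem 2.10 with the matrix
`a_{ii} = 1`, `a_{ik} = θ`. [cite: BrandenHuh2019, §2.3 proof of Thm. 2.13 ("By Theorem 2.10, we have `S(θ, f) ∈ L^d_n`")] -/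
theorem mixSubstC_eq (θ : ℝ) (f : MvPolynomial σ ℝ) :
    mixSubstC θ f = linearSubst (fun i k ↦ if i = k then (1 : ℝ) else θ) f := by
  have h : (fun i : σ ↦ ∑ k, C (if i = k then (1 : ℝ) else θ) * X k) =
      fun i ↦ ∑ k, (if i = k then (1 : ℝ) else θ) • (X k : MvPolynomial σ ℝ) := by
    funext i
    exact Finset.sum_congr rfl fun k _ ↦ (smul_eq_C_mul _ _).symm
  rw [mixSubstC, h, linearSubst]

/-- `S(0, F) = F`. [cite: BrandenHuh2019, §2.3 proof of Thm. 2.13 (the homotopy "deforms `f`": its value at `θ = 0`)] -/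
theorem mixSubstC_zero (F : MvPolynomial σ R) : mixSubstC (0 : R) F = F := by
  rw [mixSubstC]
  have h : (fun i : σ ↦ ∑ k, C (if i = k then (1 : R) else 0) * X k) = (X : σ → MvPolynomial σ R) := by
    funext i
    rw [Finset.sum_eq_single_of_mem i (Finset.mem_univ i) fun k _ hk ↦ by
      rw [if_neg (Ne.symm hk), C_0, zero_mul]]
    rw [if_pos rfl, C_1, one_mul]
  rw [h, bind₁_X_left, AlgHom.id_apply]

/-- **The homotopy `θ ↦ T_n(θ, S(θ, f))`.** [cite: BrandenHuh2019, §2.3 proof of Thm. 2.13 ("we have a homotopy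
`T_n(θ, S(θ, f)) ∈ L̊^d_n`, `0 < θ ≤ 1`")] -/
def nuijHomotopy (θ : ℝ) (j : σ) (d : ℕ) (f : MvPolynomial σ ℝ) : MvPolynomial σ ℝ :=
  nuijOperator θ j d (linearSubst (fun i k ↦ if i = k then (1 : ℝ) else θ) f)

/-- The homotopy with a generic parameter `T`: a polynomial with coefficients in `ℝ[T]` whose specialisation at
`T = θ` is `T_n(θ, S(θ, f))`. [cite: BrandenHuh2019, §2.3 proof of Thm. 2.13 (`θ` "a real parameter")] -/
theorem map_evalRingHom_nuijHomotopyC (θ : ℝ) (j : σ) (d : ℕ) (f : MvPolynomial σ ℝ) :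
    map (Polynomial.evalRingHom θ)
        (nuijOperatorC Polynomial.X j d (mixSubstC Polynomial.X (map Polynomial.C f))) =
      nuijHomotopy θ j d f := by
  have hC : (Polynomial.evalRingHom θ).comp Polynomial.C = RingHom.id ℝ := RingHom.ext fun x ↦ by simp
  rw [map_nuijOperatorC, map_mixSubstC, MvPolynomial.map_map, hC, MvPolynomial.map_id, Polynomial.coe_evalRingHom,
    Polynomial.eval_X, mixSubstC_eq, nuijOperatorC_eq, nuijHomotopy]

/-- **Every coefficient of `T_n(θ, S(θ, f))` is a polynomial — hence continuous — function of `θ`.**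
[cite: BrandenHuh2019, §2.3 proof of Thm. 2.13 ("a homotopy … that deforms `f`")] -/
theorem continuous_coeff_nuijHomotopy (j : σ) (d : ℕ) (f : MvPolynomial σ ℝ) (β : σ →₀ ℕ) :
    Continuous fun θ : ℝ ↦ coeff β (nuijHomotopy θ j d f) := by
  have h : (fun θ : ℝ ↦ coeff β (nuijHomotopy θ j d f)) = fun θ ↦
      (coeff β (nuijOperatorC Polynomial.X j d (mixSubstC Polynomial.X (map Polynomial.C f)))).eval θ := by
    funext θ
    rw [← map_evalRingHom_nuijHomotopyC, coeff_map, Polynomial.coe_evalRingHom]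
  rw [h]
  exact Polynomial.continuous _

end Generic

/-! ## §4 Theorem 2.13 and the first sentence of Theorem 2.25 -/

section Theorem213

/-- `T_n(0, S(0, f)) = f`: the homotopy starts at `f`. [cite: BrandenHuh2019, §2.3 proof of Thm. 2.13 ("deforms `f`")] -/
theorem nuijHomotopy_zero (j : σ) (d : ℕ) (f : MvPolynomial σ ℝ) : nuijHomotopy 0 j d f = f := by
  rw [nuijHomotopy, ← mixSubstC_eq, mixSubstC_zero, nuijOperator_zero]

/-- **`S(θ, f) ∈ L^d_n` for `θ ≥ 0`** (Theorem 2.10: all matrix entries `1`, `θ` are nonnegative).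
[cite: BrandenHuh2019, §2.3 proof of Thm. 2.13 ("By Theorem 2.10, we have `S(θ, f) ∈ L^d_n`")] -/
theorem mixSubst_mem_lorentzian {d : ℕ} {f : MvPolynomial σ ℝ} (hf : f ∈ lorentzian σ d) {θ : ℝ} (hθ : 0 ≤ θ) :
    linearSubst (fun i k ↦ if i = k then (1 : ℝ) else θ) f ∈ lorentzian σ d :=
  linearSubst_mem_lorentzian (fun i k ↦ by split_ifs <;> [exact zero_le_one; exact hθ]) hf

/-- **`S(θ, f) ∈ P^d_n` for `θ > 0` and `f ≠ 0`** (all matrix entries positive). [cite: BrandenHuh2019, §2.3 proof of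
Thm. 2.13 ("`S(θ, f)` belongs to `P^d_n` when `0 < θ ≤ 1`")] -/
theorem coeff_mixSubst_pos {d : ℕ} {f : MvPolynomial σ ℝ} (hf : f ∈ lorentzian σ d) (hf0 : f ≠ 0) {θ : ℝ}
    (hθ : 0 < θ) (β : σ →₀ ℕ) (hβ : β.degree = d) :
    0 < coeff β (linearSubst (fun i k ↦ if i = k then (1 : ℝ) else θ) f) :=
  coeff_linearSubst_pos (fun i k ↦ by split_ifs <;> [exact one_pos; exact hθ]) (isHomogeneous_of_mem_lorentzian hf)
    (coeff_nonneg_of_mem_lorentzian hf) hf0 β hβ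

/-- **The homotopy runs in `L̊^d_n`**: `T_n(θ, S(θ, f)) ∈ L̊^d_n` for `f ∈ L^d_n`, `f ≠ 0`, `θ > 0` (Theorem 2.10 and
Lemma 2.12). [cite: BrandenHuh2019, §2.3 proof of Thm. 2.13 ("Lemma 2.12 shows that we have a homotopy
`T_n(θ, S(θ, f)) ∈ L̊^d_n`, `0 < θ ≤ 1`")] -/
theorem nuijHomotopy_mem_strictlyLorentzian {d : ℕ} {f : MvPolynomial σ ℝ} (hf : f ∈ lorentzian σ d) (hf0 : f ≠ 0)
    {θ : ℝ} (hθ : 0 < θ) (j : σ) : nuijHomotopy θ j d f ∈ strictlyLorentzian σ d :=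
  nuijOperator_mem_strictlyLorentzian (mixSubst_mem_lorentzian hf hθ.le) (coeff_mixSubst_pos hf hf0 hθ) hθ j

/-- The coefficients of `T_n(1/(k+1), S(1/(k+1), f))` tend to those of `f`. [cite: BrandenHuh2019, §2.3 proof of
Thm. 2.13 ("It follows that the closure of `L̊^d_n` in `H^d_n` contains `L^d_n`")] -/
theorem tendsto_coeff_nuijHomotopy (j : σ) (d : ℕ) (f : MvPolynomial σ ℝ) (β : σ →₀ ℕ) :
    Tendsto (fun k : ℕ ↦ coeff β (nuijHomotopy (1 / ((k : ℝ) + 1)) j d f)) atTop (𝓝 (coeff β f)) := by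
  have hc := (continuous_coeff_nuijHomotopy j d f β).tendsto 0
  rw [nuijHomotopy_zero] at hc
  exact hc.comp tendsto_one_div_add_atTop_nhds_zero_nat

/-- **Brändén–Huh, Theorem 2.13: "The closure of `L̊^d_n` in `H^d_n` contains `L^d_n`"** — every `f ∈ L^d_n`
(Definition 2.6; `n ≥ 1`) is the coefficientwise limit of a sequence of strictly Lorentzian polynomials
(Definition 2.1): for `f ≠ 0` the homotopy `T_n(θ_k, S(θ_k, f))`, `θ_k = 1/(k+1)`; for `f = 0` the multiples
`θ_k · T_n(1, S(1, w_j^d))`. [cite: BrandenHuh2019, §2.3 Thm. 2.13 (p. 16)] -/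
theorem exists_seq_strictlyLorentzian_tendsto_coeff [Nonempty σ] {d : ℕ} {f : MvPolynomial σ ℝ}
    (hf : f ∈ lorentzian σ d) :
    ∃ F : ℕ → MvPolynomial σ ℝ, (∀ k, F k ∈ strictlyLorentzian σ d) ∧
      ∀ β : σ →₀ ℕ, Tendsto (fun k ↦ coeff β (F k)) atTop (𝓝 (coeff β f)) := by
  classical
  obtain ⟨j⟩ := ‹Nonempty σ›
  have hpos : ∀ k : ℕ, (0 : ℝ) < 1 / ((k : ℝ) + 1) := fun k ↦ by positivity
  rcases eq_or_ne f 0 with rfl | hf0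
  · -- a fixed strictly Lorentzian polynomial, scaled down to `0`
    have hX : (X j ^ d : MvPolynomial σ ℝ) ≠ 0 := pow_ne_zero d (X_ne_zero j)
    have h₀ := nuijHomotopy_mem_strictlyLorentzian (X_pow_mem_lorentzian j d) hX one_pos j
    refine ⟨fun k ↦ (1 / ((k : ℝ) + 1)) • nuijHomotopy 1 j d (X j ^ d),
      fun k ↦ smul_mem_strictlyLorentzian h₀ (hpos k), fun β ↦ ?_⟩
    simp only [coeff_smul, smul_eq_mul, coeff_zero]
    simpa using tendsto_one_div_add_atTop_nhds_zero_nat.mul_const (coeff β (nuijHomotopy 1 j d (X j ^ d)))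
  · exact ⟨fun k ↦ nuijHomotopy (1 / ((k : ℝ) + 1)) j d f,
      fun k ↦ nuijHomotopy_mem_strictlyLorentzian hf hf0 (hpos k) j, tendsto_coeff_nuijHomotopy j d f⟩

/-- **Brändén–Huh, Theorem 2.25, first sentence: "The closure of `L̊^d_n` in `H^d_n` is `L^d_n`."** For the tree's
Definition-2.6 `lorentzian` and Definition-2.1 `strictlyLorentzian` (`n ≥ 1`): `f ∈ L^d_n` iff `f` is the coefficientwise
limit of a sequence of strictly Lorentzian polynomials — Theorem 2.13 (⟹) and the closedness of `L^d_n`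
(`LorentzianClosed.mem_lorentzian_of_seq_tendsto_coeff`, ⟸). In particular Definition 2.6's `L^d_n` is exactly
Brändén–Huh's class of LORENTZIAN polynomials ("the limits of strictly Lorentzian polynomials").
[cite: BrandenHuh2019, §2.4 Thm. 2.25 (p. 24); §2.3 Thm. 2.13; §2.1 Def. 2.1] -/
theorem mem_lorentzian_iff_exists_seq_strictlyLorentzian [Nonempty σ] {d : ℕ} {f : MvPolynomial σ ℝ} :
    f ∈ lorentzian σ d ↔ ∃ F : ℕ → MvPolynomial σ ℝ, (∀ k, F k ∈ strictlyLorentzian σ d) ∧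
      ∀ β : σ →₀ ℕ, Tendsto (fun k ↦ coeff β (F k)) atTop (𝓝 (coeff β f)) :=
  ⟨exists_seq_strictlyLorentzian_tendsto_coeff, fun ⟨_, hF, hlim⟩ ↦ mem_lorentzian_of_seq_tendsto_coeff hF hlim⟩

end Theorem213

end Literature.Combinatorics.LorentzianPolynomials

end
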